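import Summits.PneNP.PneNP.Theorems.ReslinSizeFromWidthQuadraticCommonSubspace
import Summits.PneNP.PneNP.Theorems.ReslinSizeFromWidthQuadraticGlue

/-!
# PneNP / ReslinSizeFromWidth — quadratic size–width law, part 3c: the induction

Helper file for the quadratic truncation of crux `ResLinSizeFromWidth` (stmt-PneNP-18932).
THE SEMANTIC QUADRATIC LAW `B_le_length`: if every semantic refutation of `𝒞` inside the nonempty
flat `A` (axiom flats of relative rank `≤ t`) has width `≥ K`, then every such refutation has at
least `B t K = 1 + Σ_{s=t+1}^{K} s` lines.  Induction on `dim A`: prune; a reachable line of rank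
`≥ K` ends a premise chain whose last `K` lines share an equation `θ ∉ W A` (common-subspace
lemma); by gluing, either all refutations inside `H1 = A ∩ hyp (θ+1)` have width `≥ K-1` — restrict
to `H1`, losing the `K` lines inside `hyp θ`, and recurse — or all inside `H0 = A ∩ hyp θ` have width
`≥ K` — restrict to `H0` and recurse.
-/

namespace Summit.PneNP.PneNP.Theorems

-- `Summit.PneNP.PneNP` repeats a path component by design (summit = sub-problem); silence the linter.
set_option linter.dupNamespace false

namespace ResLinSW

section Induction

open Module Submodule
open scoped Pointwise

variable {V : Type*} [Fintype V]

/-! ### The induction -/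

/-- One step along a chain raises `dim W` by at most one. -/
theorem finrank_W_le_of_step {L : List (Set (V → ZMod 2))} {N P : Set (V → ZMod 2)}
    (h : Step L N P) : finrank (ZMod 2) ↥(W P) ≤ finrank (ZMod 2) ↥(W N) + 1 := by
  obtain ⟨e, he⟩ := h.le
  calc finrank (ZMod 2) ↥(W P) ≤ finrank (ZMod 2) ↥(W N ⊔ (ZMod 2) ∙ e) := Submodule.finrank_mono he
    _ ≤ finrank (ZMod 2) ↥(W N) + 1 := finrank_sup_span_singleton_le _ _

/-- **The quadratic size–width law, semantic form.** If the axiom flats meeting the nonempty flat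
`A` have relative rank `≤ t` and EVERY semantic refutation of `𝒞` inside `A` has width `≥ K`, then
every semantic refutation of `𝒞` inside `A` has at least `B t K = 1 + Σ_{s=t+1}^{K} s` lines. -/
theorem B_le_length {𝒞 : Set (Set (V → ZMod 2))} {t : ℕ} :
    ∀ (d : ℕ) (A : Set (V → ZMod 2)), IsFlat A → A.Nonempty →
      finrank (ZMod 2) (Eqn V) ≤ finrank (ZMod 2) ↥(W A) + d → GoodAxioms 𝒞 A t →
      ∀ K : ℕ, (∀ L, IsRef 𝒞 A L → K ≤ width A L) →
      ∀ L, IsRef 𝒞 A L → B t K ≤ L.length := by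
  classical
  intro d
  induction d with
  | zero =>
    intro A hA hAne hdim _ K _ L _
    exfalso
    -- W A = ⊤ ∋ one, so A = ∅
    have htop : W A = ⊤ :=
      Submodule.eq_top_of_finrank_eq (le_antisymm (Submodule.finrank_le _) (by simpa using hdim))
    have : one ∈ W A := by rw [htop]; exact Submodule.mem_top
    rw [one_mem_W_iff] at this
    rw [this] at hAne
    exact Set.not_nonempty_empty hAne
  | succ d ih =>
    intro A hA hAne hdim hg K hK L hL
    by_cases hKt : K ≤ t
    · rw [B_of_le hKt]
      exact List.length_pos_of_mem hL.root
    have hK1 : 1 ≤ K := by omega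
    -- prune
    obtain ⟨hL', hreachL'⟩ := prune hL hAne
    set L' := L.filter (reachB L A) with hL'def
    have hlenL' : L'.length ≤ L.length := List.length_filter_le _ _
    -- a reachable line of rank ≥ K
    obtain ⟨z, hzL', hzne, hzK⟩ := exists_codim_ge_of_le_width hK1 (hK L' hL')
    obtain ⟨m, c, hc0, hcm, hstep, hreach⟩ := (hreachL' z hzL').exists_chain
    -- the chain of equation spaces
    choose e he using fun i (hi : i < m) => (hstep i hi).le
    let U : ℕ → Submodule (ZMod 2) (Eqn V) := fun i => W (c i)
    let e' : ℕ → Eqn V := fun i => if hi : i < m then e i hi else 0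
    have hchain : ∀ i < m, U (i + 1) ≤ U i ⊔ (ZMod 2) ∙ e' i := by
      intro i hi
      show W (c (i + 1)) ≤ W (c i) ⊔ (ZMod 2) ∙ e' i
      simp only [e', dif_pos hi]
      exact he i hi
    -- dim W grows by ≤ 1 per step, so m ≥ K
    have hgrow : ∀ i ≤ m, finrank (ZMod 2) ↥(W (c i)) ≤ finrank (ZMod 2) ↥(W A) + i := by
      intro i hi
      induction i with
      | zero => rw [hc0]; omega
      | succ i ih' =>
        have := finrank_W_le_of_step (hstep i (by omega))
        have := ih' (by omega)
        omega
    have hzdim : finrank (ZMod 2) ↥(W A) + K ≤ finrank (ZMod 2) ↥(W z) := by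
      have hmono : finrank (ZMod 2) ↥(W A) ≤ finrank (ZMod 2) ↥(W z) :=
        Submodule.finrank_mono (W_anti (hL'.subset z hzL'))
      unfold codim at hzK
      omega
    have hmK : K ≤ m := by
      have := hgrow m le_rfl
      rw [hcm] at this
      omega
    -- the common equation θ of the last K lines of the chain, outside W A
    have hcommon := finrank_le_finrank_commonInter_add U e' m hchain (K - 1) (by omega)
    have hUm : U m = W z := by show W (c m) = W z; rw [hcm]
    rw [hUm] at hcommon
    have hnot : ¬ commonInter U m (K - 1) ≤ W A := by
      intro hle
      have := Submodule.finrank_mono hle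
      omega
    obtain ⟨θ, hθC, hθA⟩ := SetLike.not_le_iff_exists.1 hnot
    have hθc : ∀ l, m - (K - 1) ≤ l → l ≤ m → θ ∈ W (c l) :=
      fun l h1 h2 => mem_of_mem_commonInter hθC l h1 h2
    -- the two halves
    have hθz : θ ∈ W z := by rw [← hcm]; exact hθc m (by omega) le_rfl
    have h0ne : (A ∩ hyp θ).Nonempty := by
      obtain ⟨x, hx⟩ := hzne
      exact ⟨x, hL'.subset z hzL' hx, hθz x hx⟩
    have h1ne : (A ∩ hyp (θ + one)).Nonempty := by
      by_contra hcon
      rw [Set.not_nonempty_iff_eq_empty] at hcon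
      apply hθA
      intro x hx
      by_contra hxθ
      have : x ∈ A ∩ hyp (θ + one) := ⟨hx, mem_hyp_add_one_iff.2 hxθ⟩
      rw [hcon] at this
      exact Set.notMem_empty x this
    set H0 := A ∩ hyp θ with hH0
    set H1 := A ∩ hyp (θ + one) with hH1
    have hH0flat : IsFlat H0 := hA.inter (isFlat_hyp θ)
    have hH1flat : IsFlat H1 := hA.inter (isFlat_hyp _)
    have hWH0 : finrank (ZMod 2) ↥(W H0) = finrank (ZMod 2) ↥(W A) + 1 := finrank_W_section hA h0ne h1ne
    have hWH1 : finrank (ZMod 2) ↥(W H1) = finrank (ZMod 2) ↥(W A) + 1 := by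
      refine finrank_W_section hA h1ne ?_
      rw [add_one_add_one]; exact h0ne
    have hg0 : GoodAxioms 𝒞 H0 t := hg.section hA h0ne h1ne
    have hg1 : GoodAxioms 𝒞 H1 t := by
      refine hg.section hA h1ne ?_
      rw [add_one_add_one]; exact h0ne
    have hdim0 : finrank (ZMod 2) (Eqn V) ≤ finrank (ZMod 2) ↥(W H0) + d := by rw [hWH0]; omega
    have hdim1 : finrank (ZMod 2) (Eqn V) ≤ finrank (ZMod 2) ↥(W H1) + d := by rw [hWH1]; omega
    -- the dichotomy of the restriction lemma for width
    have hdich : (∀ R1, IsRef 𝒞 H1 R1 → K - 1 ≤ width H1 R1) ∨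
        (∀ R0, IsRef 𝒞 H0 R0 → K ≤ width H0 R0) := by
      by_contra hcon
      push Not at hcon
      obtain ⟨⟨R1, hR1, hw1⟩, ⟨R0, hR0, hw0⟩⟩ := hcon
      obtain ⟨G, hG, hwG⟩ := glue hg hA θ h0ne h1ne hR1 hR0
      have := hK G hG
      have : K ≤ max (width H1 R1 + 1) (max (width H0 R0) t) := this.trans hwG
      rw [le_max_iff, le_max_iff] at this
      omega
    rcases hdich with hcase | hcase
    · -- case (i): restrict the pruned refutation to H1; the K chain lines disappear
      have hR := isRef_restrict hL' hH1flat Set.inter_subset_left h1ne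
      have hBR := ih H1 hH1flat h1ne hdim1 hg1 (K - 1) hcase _ hR
      have hlen := length_restrict H1 L'
      -- the K killed lines
      have hkill : K ≤ (L'.filter fun N => !neB (N ∩ H1)).length := by
        have hinj := chain_injOn hstep
        set s : Finset (Set (V → ZMod 2)) :=
          (Finset.Icc (m - (K - 1)) m).image c with hs
        have hcard : s.card = K := by
          rw [hs, Finset.card_image_of_injOn, Nat.card_Icc]
          · omega
          · intro i hi j hj hij
            rw [Finset.coe_Icc, Set.mem_Icc] at hi hj
            exact hinj (by exact hi.2) (by exact hj.2) hij
        rw [← hcard]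
        refine card_le_length_filter _ s fun N hN => ?_
        rw [hs, Finset.mem_image] at hN
        obtain ⟨l, hl, rfl⟩ := hN
        rw [Finset.mem_Icc] at hl
        refine ⟨?_, ?_⟩
        · exact List.mem_filter.2 ⟨(hreach l hl.2).mem hL.root,
            (reachB_iff L A _).2 (hreach l hl.2)⟩
        · -- c l ⊆ hyp θ misses H1
          have hθl := hθc l hl.1 hl.2
          have hempty : c l ∩ H1 = ∅ := by
            rw [Set.eq_empty_iff_forall_notMem]
            rintro x ⟨hx, -, hx1⟩
            exact (mem_hyp_add_one_iff.1 hx1) (hθl x hx)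
          simp [hempty, neB]
      rw [B_of_lt (by omega)]
      omega
    · -- case (ii): restrict to H0
      have hR := isRef_restrict hL' hH0flat Set.inter_subset_left h0ne
      have hBR := ih H0 hH0flat h0ne hdim0 hg0 K hcase _ hR
      have hlen := length_restrict H0 L'
      omega

end Induction

end ResLinSW

end Summit.PneNP.PneNP.Theorems
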